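/-
Copyright (c) 2026 the pub-hodgecm-mathlib formalisation cell (harness21).  Prover seat hodgecm-mathlib-LD1-p02 (g0), organ payer of half-A
line LD1 (dealer LD1-plan (g0), deal (C) 2026-09-02T04:43:59Z «relative archimedean positivity», brick `hSign` of the (L) assembly), 2026-09-02.
THEOREMS ONLY (no definition, no named fact, no `sorry`, no instance, no notation).  `--supports stmt-HodgeConjecture-24832 --as helper`.
-/
import Summits.HodgeConjecture.HodgeConjecture.Theorems.F0LD2ArchSignAtAnyPhase
import Summits.HodgeConjecture.HodgeConjecture.Theorems.F0LD2ArchTypeAway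
import HarnessLib

/-!
# Brick `hSign` of line LD1's organ (L): RELATIVE ARCHIMEDEAN POSITIVITY — two holomorphic-cotangent `P`, `P′` of the CM unitary curve realised by the
# theta lifts from `⟨a′⟩`, `⟨a″⟩` (same `λ`, same frame, same pinned transport) have `0 < ρ(a′/a″)` at EVERY real place `ρ` of `L⁺`

Cell hodgecm-mathlib FLOOR 0, programme P6, half-A line LD (crux `hLiu418` = `stmt-HodgeConjecture-24832`); line LD1, organ (L) `ThetaLinePinned₂` (leaf
`Cruxes/HLiu418/Lines/F0_P6LD_StubS1FactsThetaRoad.lean` :354), assembly `F0LD1ThetaLinePinnedOfBricks.thetaLinePinned₂_of_bricks (hSLC) (hSign) (hLT)` (LD1-p01 (g0)).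
Namespace `Summit.HodgeConjecture.HodgeConjecture.Cruxes.HLiu418.F0LD1RelativeArchPositivity`.

ROAD (LD1-plan (g0) 2026-09-02T04:43:59Z (B)).  At a real place `ρ` of `L⁺` choose a complex place `w` of `L` above it; its embedding `τ` restricts to `ρ`
(Mathlib `InfinitePlace.comap_surjective`, `mk_eq_iff`; a real embedding is its own conjugate).  If `w` is the place of `ι`, the de-phased relative corollary ★
`F0LD2ArchSignAtAnyPhase.im_mul_im_pos_of_meets_of_hol₂'` gives `0 < Im τ(a′δ′) · Im τ(a″δ′)`, `δ′ = (2·imagUnit L)⁻¹`; otherwise ★ C₂away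
`F0LD2ArchTypeAway.archTypeAway₂_holds` at `(P, a′)` and at `(P′, a″)` gives the exclusive disjunction «exponent `−1` and `Im < 0`» ∕ «exponent `1` and `0 < Im`»
with the SAME exponent of `λ` at `τ`, so again `0 < Im τ(a′δ′) · Im τ(a″δ′)`.  Since `τ(a·δ′) = ρ(a) · τ(δ′)`, the product is `ρ(a′)ρ(a″)·(Im τ δ′)²`, whence
`0 < ρ(a′)ρ(a″)`, i.e. `0 < ρ(a′ · a″⁻¹)`.

* §1 `exists_embedding_over`, `im_embedding_algebraMap_mul`, `pos_div_of_mul_im_pos` — dictionary;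
* §2 **`relArchPositivity₂`** — explicit binders;  §3 **`relArchPositivity₂_holds : ‹hSign text of `F0LD1ThetaLinePinnedOfBricks` VERBATIM›**.

HONEST SCOPE.  A brick for organ (L)'s assembly (helper, `--supports`); organ (L), the line and HC_CM are NOT proved here — HC_CM stays conditional on the
remaining printed inputs (hLiu418, h413) until rung 0 closes.

## References
* [Liu2021] Y. Liu, arXiv:2102.11518, App. D Lem. D.2 (1), (3) (p. 127–128); proof of Prop. D.4 (1) (p. 131 L27–34).
* [PlatonovRapinchuk1994] V. Platonov, A. Rapinchuk, §7.3 Prop. 7.8 (local-global for norms, the consumer of this brick).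
-/

set_option autoImplicit false
set_option linter.dupNamespace false

noncomputable section

open NumberField NumberField.InfinitePlace MeasureTheory IsDedekindDomain Matrix
open scoped Matrix ComplexOrder

namespace Summit.HodgeConjecture.HodgeConjecture.Cruxes.HLiu418.F0LD1RelativeArchPositivity

open Literature.NumberTheory.Automorphic Literature.NumberTheory.Automorphic.UnitaryGroup
open Literature.NumberTheory.Automorphic.UnitaryCurveForms
open Literature.NumberTheory.Automorphic.IdeleClassGroup
open Literature.NumberTheory.Automorphic.Liu2021
open Literature.NumberTheory.GelbartRogawski1991 Literature.NumberTheory.GelbartRogawski1991.UnitaryDualPair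
open Summit.HodgeConjecture.HodgeConjecture.Cruxes.HLiu418.F0LD2ArchSignAtAnyPhase (im_mul_im_pos_of_meets_of_hol₂')
open Summit.HodgeConjecture.HodgeConjecture.Cruxes.HLiu418.F0LD2ArchTypeAway (archTypeAway₂_holds)

/-! ## §1 Dictionary -/

/-- **A complex embedding of the CM field above a given real embedding of `L⁺`** (Mathlib `comap_surjective`; a real embedding is its own conjugate).
[folklore] -/
theorem exists_place_over (L : Type) [Field L] [NumberField L] [IsCMField L] (ρ : (↥(maximalRealSubfield L)) →+* ℝ) :
    ∃ w : InfinitePlace L, ∀ x : ↥(maximalRealSubfield L), w.embedding (algebraMap (↥(maximalRealSubfield L)) L x) = ((ρ x : ℝ) : ℂ) := by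
  obtain ⟨w, hw⟩ := NumberField.InfinitePlace.comap_surjective (K := L) (k := ↥(maximalRealSubfield L))
    (NumberField.InfinitePlace.mk (Complex.ofRealHom.comp ρ))
  refine ⟨w, fun x => ?_⟩
  have h1 : NumberField.InfinitePlace.mk (w.embedding.comp (algebraMap (↥(maximalRealSubfield L)) L)) =
      NumberField.InfinitePlace.mk (Complex.ofRealHom.comp ρ) := by
    rw [← NumberField.InfinitePlace.comap_mk, NumberField.InfinitePlace.mk_embedding]; exact hw
  have hreal : NumberField.ComplexEmbedding.conjugate (Complex.ofRealHom.comp ρ) = Complex.ofRealHom.comp ρ := by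
    ext y; simp [NumberField.ComplexEmbedding.conjugate_coe_eq]
  rcases NumberField.InfinitePlace.mk_eq_iff.1 h1 with h | h
  · exact (RingHom.congr_fun h x).trans rfl
  · have h' : w.embedding.comp (algebraMap (↥(maximalRealSubfield L)) L) = Complex.ofRealHom.comp ρ := by
      rw [← hreal, ← h]
      ext y
      simp
    exact (RingHom.congr_fun h' x).trans rfl

/-- `Im τ(a · z) = ρ(a) · Im τ(z)` when `τ` lies over the real embedding `ρ`. [folklore] -/
theorem im_embedding_algebraMap_mul (L : Type) [Field L] [NumberField L] [IsCMField L] (τ : L →+* ℂ) (ρ : (↥(maximalRealSubfield L)) →+* ℝ)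
    (hτ : ∀ x : ↥(maximalRealSubfield L), τ (algebraMap (↥(maximalRealSubfield L)) L x) = ((ρ x : ℝ) : ℂ)) (a : ↥(maximalRealSubfield L)) (z : L) :
    (τ (algebraMap (↥(maximalRealSubfield L)) L a * z)).im = ρ a * (τ z).im := by
  rw [map_mul, hτ, Complex.mul_im, Complex.ofReal_re, Complex.ofReal_im, zero_mul, add_zero]

/-- `0 < x·k · (y·k)` forces `0 < x · y⁻¹` (`x, y` the values of two units). [folklore] -/
theorem pos_mul_inv_of_mul_pos {x y k : ℝ} (hy : y ≠ 0) (h : 0 < x * k * (y * k)) : 0 < x * y⁻¹ := by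
  have hxy : 0 < x * y := by nlinarith [sq_nonneg k, sq_nonneg (x * y), mul_self_nonneg k]
  have : x * y⁻¹ = (x * y) / (y * y) := by field_simp
  rw [this]
  exact div_pos hxy (mul_self_pos.2 hy)

/-! ## §2 Relative archimedean positivity, explicit binders -/

set_option maxHeartbeats 1600000 in
/-- **RELATIVE ARCHIMEDEAN POSITIVITY** (explicit binders): for the letter's field ∕ frame ∕ signature ∕ definiteness ∕ degree data, a cone frame `𝔣` at `cmPlace L ι`,
the pinned `ιA`, discrete `P`, `P′` both holomorphic-cotangent for `𝔣`, and seams `Meets(P, λ, a′, ιA)`, `Meets(P′, λ, a″, ιA)`: `0 < ρ(a′ · a″⁻¹)` at every real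
embedding `ρ` of `L⁺` (★ `im_mul_im_pos_of_meets_of_hol₂'` at the place of `ι`, ★ `archTypeAway₂_holds` twice elsewhere, §1).
[cite: Liu2021, App. D Lem. D.2 (1), (3) (p. 127–128); proof of Prop. D.4 (1) (p. 131 L27–34)] -/
theorem relArchPositivity₂ (L : Type) [Field L] [NumberField L] [IsCMField L] (ι : L →+* ℂ) (H : Matrix (Fin 2) (Fin 2) L)
    (dV : Fin 2 → L) (hdV : ∀ i, IsCMField.complexConj L (dV i) = dV i) (hdV0 : ∀ i, dV i ≠ 0)
    (t : L) (ht : t ≠ 0) (g : GL (Fin 2) L)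
    (hg : formCongr ((IsCMField.complexConj L : L ≃ₐ[↥(maximalRealSubfield L)] L) : L →+* L) g (t • H) = Matrix.diagonal dV)
    (hT : ∃ T : GL (Fin 2) ℂ, formCongr (starRingEnd ℂ) T ((Matrix.diagonal dV).map ι) = Matrix.diagonal ![(1 : ℂ), -1])
    (hpos : ∀ τ' : L →+* ℂ, InfinitePlace.mk τ' ≠ InfinitePlace.mk ι → ((Matrix.diagonal dV).map τ').PosDef)
    (h4 : 4 ≤ Module.finrank ℚ L)
    (𝔣 : ConeFrame L H (cmPlace L ι))
    {μ : Measure (adelicGroupData (↥(maximalRealSubfield L)) L (IsCMField.complexConj L) 2 H).automorphicQuotient}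
    [(adelicGroupData (↥(maximalRealSubfield L)) L (IsCMField.complexConj L) 2 H).IsAutomorphicMeasure μ]
    {n' : ℕ} (e₁ : Fin 2 × Fin 1 ≃ Fin n')
    (ιA : (adelicGroupData (↥(maximalRealSubfield L)) L (IsCMField.complexConj L) 2 H).Adelic →*
      ↥(UnitaryGroup.adelic (↥(maximalRealSubfield L)) L (IsCMField.complexConj L) 2 (Matrix.diagonal dV)))
    (hιA : ∀ k, ((ιA k : ↥(UnitaryGroup.adelic (↥(maximalRealSubfield L)) L (IsCMField.complexConj L) 2 (Matrix.diagonal dV))) :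
          GL (Fin 2) (AdeleRing (𝓞 L) L)) =
        (toAdeleGL L g)⁻¹ * adelicVal (↥(maximalRealSubfield L)) L (IsCMField.complexConj L) 2 H k * toAdeleGL L g)
    [CompactSpace (↥(UnitaryGroup.adelic (↥(maximalRealSubfield L)) L (IsCMField.complexConj L) 2 (Matrix.diagonal dV)) ⧸
        (UnitaryGroup.toAdelic (↥(maximalRealSubfield L)) L (IsCMField.complexConj L) 2 (Matrix.diagonal dV)).range)]
    (P P' : DiscreteAutomorphicRep (adelicGroupData (↥(maximalRealSubfield L)) L (IsCMField.complexConj L) 2 H) μ)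
    (lam : Literature.NumberTheory.Automorphic.IdeleClassGroup L →ₜ* Circle) (hlam : IsConjugateSymplectic L lam)
    (a' a'' : (↥(maximalRealSubfield L))ˣ)
    (hmeets : MeetsThetaLiftFromLine L 2 H e₁ dV hdV hdV0 P lam hlam a' ιA) (hmeets' : MeetsThetaLiftFromLine L 2 H e₁ dV hdV hdV0 P' lam hlam a'' ιA)
    (hhol : P.IsHolCotangentAt₂ (IsCMField.complexConj_ne_one L) (UnitaryGroup.complexConj_smul_infinitePlace L) (cmPlace L ι) 𝔣)
    (hhol' : P'.IsHolCotangentAt₂ (IsCMField.complexConj_ne_one L) (UnitaryGroup.complexConj_smul_infinitePlace L) (cmPlace L ι) 𝔣)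
    (ρ : (↥(maximalRealSubfield L)) →+* ℝ) :
    0 < ρ ((a' : ↥(maximalRealSubfield L)) * ((a'' : ↥(maximalRealSubfield L)))⁻¹) := by
  obtain ⟨w, hw⟩ := exists_place_over L ρ
  -- the product of the two imaginary parts at the embedding of `w`
  have hprod : 0 < (w.embedding (algebraMap (↥(maximalRealSubfield L)) L a' * (2 * imagUnit L)⁻¹)).im *
      (w.embedding (algebraMap (↥(maximalRealSubfield L)) L a'' * (2 * imagUnit L)⁻¹)).im := by
    by_cases hwι : w = InfinitePlace.mk ι
    · -- the place of `ι`: the de-phased relative corollary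
      have he : (cmPlace L ι).1 = w := hwι.symm
      have key := im_mul_im_pos_of_meets_of_hol₂' L ι H dV hdV hdV0 t ht g hg hT hpos h4 𝔣 e₁ ιA hιA P P' lam hlam a' a'' hmeets hmeets' hhol hhol'
      rw [he] at key
      exact key
    · -- off the place of `ι`: C₂away twice, same exponent
      have hτ : InfinitePlace.mk w.embedding ≠ InfinitePlace.mk ι := by rw [NumberField.InfinitePlace.mk_embedding]; exact hwι
      have h1 := archTypeAway₂_holds L ι H dV hdV hdV0 t ht g hg hT hpos h4 𝔣 μ e₁ ιA hιA P lam hlam a' hmeets hhol w.embedding hτ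
      have h2 := archTypeAway₂_holds L ι H dV hdV hdV0 t ht g hg hT hpos h4 𝔣 μ e₁ ιA hιA P' lam hlam a'' hmeets' hhol' w.embedding hτ
      rcases h1 with ⟨e1, s1⟩ | ⟨e1, s1⟩ <;> rcases h2 with ⟨e2, s2⟩ | ⟨e2, s2⟩
      · exact mul_pos_of_neg_of_neg s1 s2
      · exfalso; rw [e1] at e2; norm_num at e2
      · exfalso; rw [e1] at e2; norm_num at e2
      · exact mul_pos s1 s2
  rw [im_embedding_algebraMap_mul L w.embedding ρ hw, im_embedding_algebraMap_mul L w.embedding ρ hw] at hprod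
  have hy : ρ (a'' : ↥(maximalRealSubfield L)) ≠ 0 := (map_ne_zero ρ).2 (Units.ne_zero a'')
  rw [map_mul, map_inv₀]
  exact pos_mul_inv_of_mul_pos hy hprod

/-! ## §3 The brick `hSign` of `F0LD1ThetaLinePinnedOfBricks.thetaLinePinned₂_of_bricks`, token for token -/

set_option maxHeartbeats 1600000 in
/-- **BRICK `hSign` PAID — `relArchPositivity₂_holds : ‹the hypothesis `hSign` of `F0LD1ThetaLinePinnedOfBricks.thetaLinePinned₂_of_bricks`, VERBATIM›**
(organ (L)'s prefix Γ through `HasWeight L lam 1 →`, then the pinned `ιA`, `[CompactSpace [U(diag dV)]]`, `P P′` holomorphic-cotangent for `𝔣`, seams from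
`⟨a′⟩`, `⟨a″⟩`, every real embedding `ρ` of `L⁺`): `0 < ρ(a′ · a″⁻¹)` — §2. [cite: Liu2021, App. D Lem. D.2 (1), (3) (p. 127–128); proof of Prop. D.4 (1) (p. 131 L27–34)] -/
theorem relArchPositivity₂_holds :
    ∀ (L : Type) [Field L] [NumberField L] [IsCMField L] (ι : L →+* ℂ) (H : Matrix (Fin 2) (Fin 2) L)
        (dV : Fin 2 → L) (hdV : ∀ i, IsCMField.complexConj L (dV i) = dV i) (hdV0 : ∀ i, dV i ≠ 0)
        (t : L) (ht : t ≠ 0) (g : GL (Fin 2) L)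
        (hg : formCongr ((IsCMField.complexConj L : L ≃ₐ[↥(maximalRealSubfield L)] L) : L →+* L) g (t • H) = Matrix.diagonal dV),
        (∃ T : GL (Fin 2) ℂ, formCongr (starRingEnd ℂ) T ((Matrix.diagonal dV).map ι) = Matrix.diagonal ![(1 : ℂ), -1]) →
        (∀ τ' : L →+* ℂ, InfinitePlace.mk τ' ≠ InfinitePlace.mk ι → ((Matrix.diagonal dV).map τ').PosDef) →
        4 ≤ Module.finrank ℚ L →
        ∀ (𝔣 : ConeFrame L H (cmPlace L ι))
          (μ : Measure (adelicGroupData (↥(maximalRealSubfield L)) L (IsCMField.complexConj L) 2 H).automorphicQuotient)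
          [(adelicGroupData (↥(maximalRealSubfield L)) L (IsCMField.complexConj L) 2 H).IsAutomorphicMeasure μ]
          {n' : ℕ} (e₁ : Fin 2 × Fin 1 ≃ Fin n')
          (lam : Literature.NumberTheory.Automorphic.IdeleClassGroup L →ₜ* Circle) (hlam : IsConjugateSymplectic L lam), HasWeight L lam 1 →
        ∀ (ιA : (adelicGroupData (↥(maximalRealSubfield L)) L (IsCMField.complexConj L) 2 H).Adelic →*
            ↥(UnitaryGroup.adelic (↥(maximalRealSubfield L)) L (IsCMField.complexConj L) 2 (Matrix.diagonal dV))),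
          (∀ k, ((ιA k : ↥(UnitaryGroup.adelic (↥(maximalRealSubfield L)) L (IsCMField.complexConj L) 2 (Matrix.diagonal dV))) :
                GL (Fin 2) (AdeleRing (𝓞 L) L)) =
              (toAdeleGL L g)⁻¹ * adelicVal (↥(maximalRealSubfield L)) L (IsCMField.complexConj L) 2 H k * toAdeleGL L g) →
        ∀ [CompactSpace (↥(UnitaryGroup.adelic (↥(maximalRealSubfield L)) L (IsCMField.complexConj L) 2 (Matrix.diagonal dV)) ⧸
            (UnitaryGroup.toAdelic (↥(maximalRealSubfield L)) L (IsCMField.complexConj L) 2 (Matrix.diagonal dV)).range)],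
        ∀ P P' : DiscreteAutomorphicRep (adelicGroupData (↥(maximalRealSubfield L)) L (IsCMField.complexConj L) 2 H) μ,
          P.IsHolCotangentAt₂ (IsCMField.complexConj_ne_one L) (UnitaryGroup.complexConj_smul_infinitePlace L) (cmPlace L ι) 𝔣 →
          P'.IsHolCotangentAt₂ (IsCMField.complexConj_ne_one L) (UnitaryGroup.complexConj_smul_infinitePlace L) (cmPlace L ι) 𝔣 →
        ∀ (a' a'' : (↥(maximalRealSubfield L))ˣ),
          MeetsThetaLiftFromLine L 2 H e₁ dV hdV hdV0 P lam hlam a' ιA → MeetsThetaLiftFromLine L 2 H e₁ dV hdV hdV0 P' lam hlam a'' ιA →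
          ∀ ρ : (↥(maximalRealSubfield L)) →+* ℝ, 0 < ρ ((a' : (↥(maximalRealSubfield L))) * ((a'' : (↥(maximalRealSubfield L))))⁻¹) := by
  intro L _ _ _ ι H dV hdV hdV0 t ht g hg hT hpos h4 𝔣 μ _ n' e₁ lam hlam _hw ιA hιA _ P P' hhol hhol' a' a'' hmeets hmeets' ρ
  exact relArchPositivity₂ L ι H dV hdV hdV0 t ht g hg hT hpos h4 𝔣 e₁ ιA hιA P P' lam hlam a' a'' hmeets hmeets' hhol hhol' ρ

end Summit.HodgeConjecture.HodgeConjecture.Cruxes.HLiu418.F0LD1RelativeArchPositivity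

end
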